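import Literature.Geometry.Riemannian.SphericalZonalKernelSeries
import Literature.Analysis.SpecialFunctions.GegenbauerOrthogonality
import Mathlib.MeasureTheory.Integral.DominatedConvergence
import Mathlib.Algebra.Polynomial.Sequence
import HarnessLib

/-!
# Duality for the `S⁴` zonal heat series: `∫ (1-s²) zonal(τ,s) p(s) ds = h₀ (P_τ p)(1)`

Companion of `SphericalZonalSixDuality.lean` (which does the same for the `S⁶` series `zonalSix`,
weight `(1-s²)²`), for the typed `S⁴` series of `SphericalCylinderEntropy`,
`zonal τ s = ∑_k e^{-k(k+3)τ} (2k+3)/3 · C_k^{(3/2)}(s)` (weight `1 - s²`, parameter `a = 3/2 = 1 + 1/2`,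
i.e. `k = 1` in the `S^{2k+2}` bookkeeping of `GegenbauerOrthogonality.lean` /
`GegenbauerHeatPositivity.lean`).  For `τ > 0` the series is tested against polynomials written in
the Gegenbauer basis, `p = Σ_{j<J} b_j C_j^{(3/2)}` (the time-`0` value of the polynomial heat flow
`gegenbauerHeat 1 b J` of `GegenbauerHeatPositivity.lean`):

* `gegen_eq_gegenbauerSum` — `gegen j = gegenbauerSum (1 + 1/2) j` (same explicit sum);
* `hasSum_integral_weightOne_mul_term_mul` — dominated convergence: for continuous `g`,
  `Σ_i ∫_{-1}^{1} (1-s²) (wt i τ C_i(s)) g(s) ds = ∫_{-1}^{1} (1-s²) zonal(τ,s) g(s) ds`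
  (uniform majorant of `SphericalZonalKernelSeries` on `[-1,1]`);
* `integral_weightOne_mul_zonal_mul_gegenbauerHeat` — **duality**: by orthogonality and the norm
  identity `(j + 3/2) h_j = (3/2) h₀ C_j(1)` (`GegenbauerOrthogonality.gegenbauerNormSq_eq`), i.e.
  `(2j+3)/3 · h_j = h₀ C_j(1)` (`h₀ = ∫_{-1}^{1} (1-s²) = 4/3`),
  `∫ (1-s²) zonal(τ,s) p(s) ds = h₀ · Σ_{j<J} b_j e^{-j(j+3)τ} C_j(1) = h₀ (P_τ p)(1)`
  — the zonal form of `(e^{τΔ} p)(pole) = ∫_{S⁴} K_τ(pole, ·) p`;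
* `integral_weightOne_mul_zonal_mul_nonneg_of_gegenbauerHeat` — hence `≥ 0` whenever `p ≥ 0` on
  `[-1,1]`, by positivity preservation (`gegenbauerHeat_nonneg`);
* `exists_gegenbauerHeat_one_eq_eval` — every real polynomial is such a `p` (the `C_j^{(3/2)}`, as
  elements of `ℝ[X]`, have exact degree `j`: `degree_gegenFourPoly`, `Polynomial.Sequence.span_degreeLT`).

This is the duality input of the Cheeger–Yau lower bound for the typed `S⁴` kernel
(`CheegerYauZonalSphereFour` of `SphericalCylinderSmallScaleDomination.lean`).
Everything is proved; no named facts.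

## References
* E. B. Davies, *Heat Kernels and Spectral Theory*, CUP 1989, Ch. 5.
* G. E. Andrews, R. Askey, R. Roy, *Special Functions*, CUP 1999, §6.4, §9.6.
-/

noncomputable section

open scoped BigOperators Topology Nat Polynomial Interval
open Filter Set MeasureTheory intervalIntegral Polynomial
open Literature.Geometry.Riemannian.SphericalCylinderEntropy
open Literature.Analysis.SpecialFunctions

namespace Literature.Geometry.Riemannian.SphericalZonalKernelSeries

/-! ### The `S⁴` objects in terms of the general Gegenbauer sums (`k = 1`, `a = 3/2`) -/

/-- `gegen j = C_j^{(1 + 1/2)}` as explicit sums. [folklore] -/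
theorem gegen_eq_gegenbauerSum (j : ℕ) (s : ℝ) :
    gegen j s = gegenbauerSum (((1 : ℕ) : ℝ) + 1 / 2) j s := by
  have h : (((1 : ℕ) : ℝ) + 1 / 2) = (3 : ℝ) / 2 := by norm_num
  rw [h]
  simp only [gegen, gegenbauerSum, gegenbauerCoeff]

/-- The `S⁴` weight in the form `wt j τ = e^{-j(j+2·1+1)τ} · ((j + a)/a)` with `a = 1 + 1/2`
(`(2j+3)/3 = (j + 3/2)/(3/2)`). [folklore] -/
theorem wt_eq (j : ℕ) (τ : ℝ) :
    wt j τ = Real.exp (-((j : ℝ) * ((j : ℝ) + 2 * (1 : ℕ) + 1) * τ)) *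
      (((j : ℝ) + (((1 : ℕ) : ℝ) + 1 / 2)) / (((1 : ℕ) : ℝ) + 1 / 2)) := by
  unfold wt
  have h : Real.exp (-((j : ℝ) * ((j : ℝ) + 3)) * τ) =
      Real.exp (-((j : ℝ) * ((j : ℝ) + 2 * (1 : ℕ) + 1) * τ)) := by
    congr 1; push_cast; ring
  rw [h]
  push_cast
  congr 1
  field_simp
  ring

/-- `gegen j` is continuous. [folklore] -/
theorem continuous_gegen (j : ℕ) : Continuous (gegen j) := by
  unfold gegen; fun_prop

/-! ### Interchanging the series and the integral on `[-1, 1]` -/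

/-- **Dominated convergence**: for continuous `g`, the term-wise integrals
`∫_{-1}^{1} (1-s²) (wt i τ C_i(s)) g(s) ds` sum to `∫_{-1}^{1} (1-s²) zonal(τ,s) g(s) ds`.
[folklore] -/
theorem hasSum_integral_weightOne_mul_term_mul {τ : ℝ} (hτ : 0 < τ) {g : ℝ → ℝ}
    (hg : Continuous g) :
    HasSum (fun i : ℕ => ∫ s in (-1 : ℝ)..1, (1 - s ^ 2) * (wt i τ * gegen i s) * g s)
      (∫ s in (-1 : ℝ)..1, (1 - s ^ 2) * zonal τ s * g s) := by
  -- a bound for `|(1-s²) g|` on `[-1, 1]`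
  obtain ⟨M, hM⟩ := isCompact_Icc.exists_bound_of_continuousOn (s := Icc (-1 : ℝ) 1)
    ((by fun_prop : Continuous fun s : ℝ => (1 - s ^ 2) * g s).continuousOn)
  set u : ℕ → ℝ := fun i =>
    Real.exp (-(i : ℝ) ^ 2 * τ) * (((i + 3).factorial : ℕ) : ℝ) ^ 2 * (2 * 1) ^ i with hu
  have hus : Summable u := summable_majorant hτ (by norm_num)
  have hIoc : Ι (-1 : ℝ) 1 = Set.Ioc (-1) 1 := Set.uIoc_of_le (by norm_num)
  refine intervalIntegral.hasSum_integral_of_dominated_convergence (fun i _ => u i * M)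
    (fun i => ?_) (fun i => ae_of_all _ fun s hs => ?_) (ae_of_all _ fun s _ => hus.mul_right M)
    intervalIntegrable_const (ae_of_all _ fun s _ => ?_)
  · have hc := continuous_gegen i
    exact (by fun_prop : Continuous fun s : ℝ => (1 - s ^ 2) * (wt i τ * gegen i s) *
      g s).aestronglyMeasurable
  · rw [hIoc] at hs
    have hs1 : |s| ≤ 1 := abs_le.2 ⟨hs.1.le, hs.2⟩
    have h1 := norm_wt_mul_gegen_le hτ le_rfl hs1 i
    have h2 := hM s ⟨hs.1.le, hs.2⟩
    rw [show (1 - s ^ 2) * (wt i τ * gegen i s) * g s =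
      (wt i τ * gegen i s) * ((1 - s ^ 2) * g s) by ring, norm_mul]
    exact mul_le_mul h1 h2 (norm_nonneg _) ((norm_nonneg _).trans h1)
  · have h := ((summable_wt_mul_gegen hτ s).hasSum.mul_left (1 - s ^ 2)).mul_right (g s)
    refine h.congr_fun ?_
    intro i
    ring

/-! ### Duality against the polynomial heat flow -/

/-- The term-wise integrals against `p = Σ_{j<J} b_j C_j` (`= gegenbauerHeat 1 b J · 0`):
`∫ (1-s²) (wt i τ C_i) p = wt i τ · b_i h_i` for `i < J` and `0` otherwise (orthogonality).
[folklore] -/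
theorem integral_weightOne_mul_term_mul_gegenbauerHeat (τ : ℝ) (b : ℕ → ℝ) (J i : ℕ) :
    ∫ s in (-1 : ℝ)..1, (1 - s ^ 2) * (wt i τ * gegen i s) * gegenbauerHeat 1 b J s 0 =
      if i < J then wt i τ * b i * ∫ s in (-1 : ℝ)..1, (1 - s ^ 2) ^ 1 *
        (gegenbauerSum (((1 : ℕ) : ℝ) + 1 / 2) i s * gegenbauerSum (((1 : ℕ) : ℝ) + 1 / 2) i s)
      else 0 := by
  set a : ℝ := ((1 : ℕ) : ℝ) + 1 / 2 with ha
  have hc : ∀ m : ℕ, Continuous (gegenbauerSum a m) := continuous_gegenbauerSum a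
  -- expand `p` and pull the finite sum out of the integral
  have hp : ∀ s : ℝ, (1 - s ^ 2) * (wt i τ * gegen i s) * gegenbauerHeat 1 b J s 0 =
      ∑ j ∈ Finset.range J, wt i τ * b j *
        ((1 - s ^ 2) ^ 1 * (gegenbauerSum a i s * gegenbauerSum a j s)) := by
    intro s
    simp only [gegenbauerHeat, mul_zero, neg_zero, Real.exp_zero, mul_one, gegen_eq_gegenbauerSum,
      Finset.mul_sum, pow_one]
    refine Finset.sum_congr rfl fun j _ => ?_
    ring
  simp_rw [hp]
  rw [intervalIntegral.integral_finsetSum fun j _ =>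
    ((by fun_prop : Continuous fun s : ℝ => wt i τ * b j *
      ((1 - s ^ 2) ^ 1 * (gegenbauerSum a i s * gegenbauerSum a j s))).intervalIntegrable _ _)]
  simp_rw [intervalIntegral.integral_const_mul]
  split_ifs with hi
  · rw [Finset.sum_eq_single_of_mem i (Finset.mem_range.2 hi)]
    intro j _ hji
    rw [integral_weight_mul_gegenbauerSum_mul_eq_zero 1 (Ne.symm hji), mul_zero]
  · refine Finset.sum_eq_zero fun j hj => ?_
    have hji : i ≠ j := by
      intro h; exact hi (h ▸ Finset.mem_range.1 hj)
    rw [integral_weight_mul_gegenbauerSum_mul_eq_zero 1 hji, mul_zero]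

/-- **Duality**: `∫_{-1}^{1} (1-s²) zonal(τ,s) p(s) ds = h₀ · (P_τ p)(1)` for
`p = Σ_{j<J} b_j C_j^{(3/2)}`, where `P_τ p = gegenbauerHeat 1 b J · τ` is the polynomial heat flow and
`h₀ = ∫_{-1}^{1} (1-s²)` (orthogonality, `(2j+3)/3 · h_j = h₀ C_j(1)`): the zonal form of
`∫_{S⁴} K_τ(pole, y) p(y) dy = (e^{τΔ} p)(pole)`. [folklore] -/
theorem integral_weightOne_mul_zonal_mul_gegenbauerHeat {τ : ℝ} (hτ : 0 < τ) (b : ℕ → ℝ) (J : ℕ) :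
    ∫ s in (-1 : ℝ)..1, (1 - s ^ 2) * zonal τ s * gegenbauerHeat 1 b J s 0 =
      (∫ s in (-1 : ℝ)..1, (1 - s ^ 2)) * gegenbauerHeat 1 b J 1 τ := by
  set a : ℝ := ((1 : ℕ) : ℝ) + 1 / 2 with ha
  have hpc : Continuous fun s => gegenbauerHeat 1 b J s 0 :=
    (continuous_gegenbauerHeat 1 b J).comp (Continuous.prodMk_left (0 : ℝ))
  have h1 := hasSum_integral_weightOne_mul_term_mul hτ hpc
  -- the term-wise integrals form a finitely supported sequence
  set c : ℕ → ℝ := fun i => if i < J then wt i τ * b i * ∫ s in (-1 : ℝ)..1, (1 - s ^ 2) ^ 1 *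
    (gegenbauerSum a i s * gegenbauerSum a i s) else 0 with hcdef
  have h2 : HasSum c (∑ i ∈ Finset.range J, c i) := by
    refine hasSum_sum_of_ne_finset_zero fun i hi => ?_
    simp only [hcdef, if_neg (fun h => hi (Finset.mem_range.2 h))]
  have h1' : HasSum c (∫ s in (-1 : ℝ)..1, (1 - s ^ 2) * zonal τ s * gegenbauerHeat 1 b J s 0) := by
    refine h1.congr_fun fun i => ?_
    rw [hcdef]
    exact (integral_weightOne_mul_term_mul_gegenbauerHeat τ b J i).symm
  rw [h1'.unique h2]
  -- evaluate the finite sum with the norm identity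
  unfold gegenbauerHeat
  rw [Finset.mul_sum]
  refine Finset.sum_congr rfl fun i hi => ?_
  have hiJ := Finset.mem_range.1 hi
  simp only [hcdef, if_pos hiJ]
  have hn := gegenbauerNormSq_eq 1 i
  have hw0 : (∫ s in (-1 : ℝ)..1, (1 - s ^ 2) ^ 1) = ∫ s in (-1 : ℝ)..1, (1 - s ^ 2) := by
    simp only [pow_one]
  rw [hw0] at hn
  rw [wt_eq]
  set h0 := ∫ s in (-1 : ℝ)..1, (1 - s ^ 2)
  set hi' := ∫ s in (-1 : ℝ)..1, (1 - s ^ 2) ^ 1 * (gegenbauerSum a i s * gegenbauerSum a i s)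
  set G := gegenbauerSum (((1 : ℕ) : ℝ) + 1 / 2) i 1 with hG
  set e := Real.exp (-((i : ℝ) * ((i : ℝ) + 2 * (1 : ℕ) + 1) * τ)) with he
  push_cast at hn ⊢
  have ha0 : (1 : ℝ) + 1 / 2 ≠ 0 := by norm_num
  have key : ((i : ℝ) + (1 + 1 / 2)) / (1 + 1 / 2) * hi' = h0 * G := by
    rw [div_mul_eq_mul_div, div_eq_iff ha0]
    linear_combination hn
  calc e * (((i : ℝ) + (1 + 1 / 2)) / (1 + 1 / 2)) * b i * hi'
      = e * b i * (((i : ℝ) + (1 + 1 / 2)) / (1 + 1 / 2) * hi') := by ring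
    _ = e * b i * (h0 * G) := by rw [key]
    _ = h0 * (b i * e * G) := by ring

/-- `h₀ = ∫_{-1}^{1} (1-s²) = 4/3`. [folklore] -/
theorem integral_weightOne_eq : ∫ s in (-1 : ℝ)..1, (1 - s ^ 2) = 4 / 3 := by
  rw [intervalIntegral.integral_sub intervalIntegrable_const
    ((by fun_prop : Continuous fun s : ℝ => s ^ 2).intervalIntegrable _ _),
    intervalIntegral.integral_const, integral_pow]
  norm_num

/-- **Positivity of the pairing**: if `p = Σ_{j<J} b_j C_j^{(3/2)} ≥ 0` on `[-1,1]` then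
`∫_{-1}^{1} (1-s²) zonal(τ,s) p(s) ds ≥ 0` (duality + positivity preservation). [folklore] -/
theorem integral_weightOne_mul_zonal_mul_nonneg_of_gegenbauerHeat {τ : ℝ} (hτ : 0 < τ) (b : ℕ → ℝ)
    (J : ℕ) (h0 : ∀ s ∈ Icc (-1 : ℝ) 1, 0 ≤ gegenbauerHeat 1 b J s 0) :
    0 ≤ ∫ s in (-1 : ℝ)..1, (1 - s ^ 2) * zonal τ s * gegenbauerHeat 1 b J s 0 := by
  rw [integral_weightOne_mul_zonal_mul_gegenbauerHeat hτ, integral_weightOne_eq]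
  exact mul_nonneg (by norm_num)
    (gegenbauerHeat_nonneg 1 b J h0 hτ.le ⟨by norm_num, le_rfl⟩)

/-! ### Every polynomial is a finite Gegenbauer combination -/

/-- `C_j^{(3/2)}` as an element of `ℝ[X]`, `Σ_l c_l 2^{j-2l} X^{j-2l}`, evaluates to the explicit sum
`gegenbauerSum (1 + 1/2) j`. [folklore] -/
theorem eval_gegenFourPoly (j : ℕ) (s : ℝ) :
    (∑ l ∈ Finset.range (j / 2 + 1), C (gegenbauerCoeff (((1 : ℕ) : ℝ) + 1 / 2) j l *
      2 ^ (j - 2 * l)) * X ^ (j - 2 * l) : ℝ[X]).eval s = gegenbauerSum (((1 : ℕ) : ℝ) + 1 / 2) j s := by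
  unfold gegenbauerSum
  rw [eval_finsetSum]
  refine Finset.sum_congr rfl fun l _ => ?_
  rw [eval_mul, eval_C, eval_pow, eval_X, mul_pow]
  ring

/-- Its coefficient of `X^j` is `c_0 2^j = (a)_j 2^j / j!`. [folklore] -/
theorem coeff_gegenFourPoly_self (j : ℕ) :
    (∑ l ∈ Finset.range (j / 2 + 1), C (gegenbauerCoeff (((1 : ℕ) : ℝ) + 1 / 2) j l *
      2 ^ (j - 2 * l)) * X ^ (j - 2 * l) : ℝ[X]).coeff j =
      gegenbauerCoeff (((1 : ℕ) : ℝ) + 1 / 2) j 0 * 2 ^ j := by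
  rw [finsetSum_coeff, Finset.sum_eq_single_of_mem 0 (Finset.mem_range.2 (by omega))]
  · rw [Nat.mul_zero, Nat.sub_zero, coeff_C_mul_X_pow]
    simp
  · intro l hl hl0
    have := Finset.mem_range.1 hl
    rw [coeff_C_mul_X_pow, if_neg (by omega)]

/-- `C_j^{(3/2)}` has degree exactly `j` in `ℝ[X]` (its leading coefficient `(a)_j 2^j/j!` is
positive). [folklore] -/
theorem degree_gegenFourPoly (j : ℕ) :
    (∑ l ∈ Finset.range (j / 2 + 1), C (gegenbauerCoeff (((1 : ℕ) : ℝ) + 1 / 2) j l *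
      2 ^ (j - 2 * l)) * X ^ (j - 2 * l) : ℝ[X]).degree = j := by
  refine degree_eq_of_le_of_coeff_ne_zero ?_ ?_
  · refine (degree_le_natDegree).trans ?_
    rw [Nat.cast_le]
    refine natDegree_sum_le_of_forall_le _ _ fun l _ => ?_
    exact (natDegree_C_mul_X_pow_le _ _).trans (by omega)
  · rw [coeff_gegenFourPoly_self, gegenbauerCoeff]
    have hp : 0 < ∏ i ∈ Finset.range (j - 0), ((((1 : ℕ) : ℝ) + 1 / 2) + (i : ℝ)) :=
      Finset.prod_pos fun i _ => by positivity
    positivity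

/-- **Every real polynomial is a finite Gegenbauer combination**: `q = Σ_{j<J} b_j C_j^{(3/2)}` on
`ℝ`, i.e. `q.eval = gegenbauerHeat 1 b J · 0` for some `J`, `b` (the `C_j^{(3/2)}` form a
`Polynomial.Sequence` with unit leading coefficients, `Polynomial.Sequence.span_degreeLT`). [folklore] -/
theorem exists_gegenbauerHeat_one_eq_eval (q : ℝ[X]) :
    ∃ (J : ℕ) (b : ℕ → ℝ), ∀ s : ℝ, gegenbauerHeat 1 b J s 0 = q.eval s := by
  set S : Polynomial.Sequence ℝ := ⟨fun j => ∑ l ∈ Finset.range (j / 2 + 1),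
    C (gegenbauerCoeff (((1 : ℕ) : ℝ) + 1 / 2) j l * 2 ^ (j - 2 * l)) * X ^ (j - 2 * l),
    degree_gegenFourPoly⟩ with hSdef
  have hS : ∀ j : ℕ, (S : ℕ → ℝ[X]) j = ∑ l ∈ Finset.range (j / 2 + 1),
      C (gegenbauerCoeff (((1 : ℕ) : ℝ) + 1 / 2) j l * 2 ^ (j - 2 * l)) * X ^ (j - 2 * l) :=
    fun j => rfl
  set m := q.natDegree + 1 with hm
  have hspan := Polynomial.Sequence.span_degreeLT S (m := m) fun i _ =>
    isUnit_iff_ne_zero.2 (leadingCoeff_ne_zero.2 (S.ne_zero i))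
  have hq : q ∈ Polynomial.degreeLT ℝ m := by
    rw [Polynomial.mem_degreeLT]
    exact (degree_le_natDegree).trans_lt (by rw [hm]; exact_mod_cast Nat.lt_succ_self _)
  rw [← hspan] at hq
  have hset : (S : ℕ → ℝ[X]) '' Set.Iio m = Set.range (fun i : Fin m => (S : ℕ → ℝ[X]) i) := by
    ext p
    simp only [Set.mem_image, Set.mem_Iio, Set.mem_range]
    constructor
    · rintro ⟨i, hi, rfl⟩
      exact ⟨⟨i, hi⟩, rfl⟩
    · rintro ⟨i, rfl⟩
      exact ⟨i, i.is_lt, rfl⟩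
  rw [hset, Submodule.mem_span_range_iff_exists_fun] at hq
  obtain ⟨c, hc⟩ := hq
  refine ⟨m, fun j => if h : j < m then c ⟨j, h⟩ else 0, fun s => ?_⟩
  have hqe : q = ∑ j ∈ Finset.range m, (if h : j < m then c ⟨j, h⟩ else 0) • (S : ℕ → ℝ[X]) j := by
    rw [← hc, ← Fin.sum_univ_eq_sum_range (fun j =>
      (if h : j < m then c ⟨j, h⟩ else 0) • (S : ℕ → ℝ[X]) j)]
    refine Finset.sum_congr rfl fun i _ => ?_
    simp [i.is_lt]
  rw [hqe, eval_finsetSum]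
  unfold gegenbauerHeat
  refine Finset.sum_congr rfl fun j hj => ?_
  have hjm := Finset.mem_range.1 hj
  simp only [dif_pos hjm, smul_eq_mul, eval_smul, mul_zero, neg_zero, Real.exp_zero, mul_one]
  congr 1
  rw [hS]
  exact (eval_gegenFourPoly j s).symm

/-- **`∫_{-1}^{1} (1-s²) zonal(τ,s) q(s) ds ≥ 0` for every real polynomial `q ≥ 0` on `[-1,1]`.**
[folklore] -/
theorem integral_weightOne_mul_zonal_mul_eval_nonneg {τ : ℝ} (hτ : 0 < τ) (q : ℝ[X])
    (hq : ∀ s ∈ Icc (-1 : ℝ) 1, 0 ≤ q.eval s) :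
    0 ≤ ∫ s in (-1 : ℝ)..1, (1 - s ^ 2) * zonal τ s * q.eval s := by
  obtain ⟨J, b, hb⟩ := exists_gegenbauerHeat_one_eq_eval q
  simp_rw [← hb]
  exact integral_weightOne_mul_zonal_mul_nonneg_of_gegenbauerHeat hτ b J fun s hs =>
    (hb s).symm ▸ hq s hs

end Literature.Geometry.Riemannian.SphericalZonalKernelSeries
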